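import Summits.SmoothPoincare4.SmoothPoincare4.Theses.EntropyRung
import Literature.Geometry.Lorentzian.Basic
import Summits.SmoothPoincare4.SmoothPoincare4.Theorems.EntropyRungNoncompactShrinkerGapStubModelValueSplitLineProfile
import Summits.SmoothPoincare4.SmoothPoincare4.Theorems.EntropyRungNoncompactShrinkerGapStubModelValueSplitLineGaussian
import Summits.SmoothPoincare4.SmoothPoincare4.Theorems.EntropyRungNoncompactShrinkerGapStubModelValueSplitLineShrinker
import Mathlib.MeasureTheory.Integral.Prod
import Mathlib.Geometry.Manifold.ContMDiff.Constructions

/-!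
# Stub `stub_modelValueSplitLine` (U2) of line `collapsed-ends-usc`, crux
# `EntropyRung.NoncompactShrinkerGap` (stmt-SmoothPoincare4-10868) — the model value on `N × ℝ`

The registered stub `stub_modelValueSplitLine` (skeleton v2 of the line): for a complete connected
normalised 3-d gradient shrinker `(N, h, φ)` (`Ric_h + Hess φ = h/2`, `R_h + |∇φ|² = φ`) and every
`ε > 0` there is a smooth compactly supported `W` on `N × ℝ`, supported in `{φ < R} × (−R, R)`,
with `∫ W² > 0`, whose Perelman functional on `(N × ℝ, dV_h ⊗ dt)` (written out with
`|∇W|² = |∇_h W(·,t)|² + (∂_t W)²`, `R_{N×ℝ} = R_h`) is `≤ log((4π)⁻² · 2√π ∫_N e^{-φ} dV_h) + ε` —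
the last inequality of the lever `∫_M e^{-f} ≤ 2√π ∫_N e^{-φ}` (glue
`collapsedDirectionReduction_of_usc`).

PROOF (Haslhofer–Müller 2011 §2 / Carrillo–Ni 2009 §4, as in the line's plan). Test functions
`W_K(y, t) = F_K(φ(y)) F_K(t²/4)`, `F_K(s) = ρ(s/K) e^{-s/2}` (`ρ` a smooth cut-off, part 1,
`…StubModelValueSplitLineProfile`). Every term of the functional factorises (Fubini,
`integral_prod_mul`) into the nine factor integrals `A₁,…,A₅` on `N` and `B₁,…,B₄` on `ℝ`
(`integrand_eq`, `integral_integrand_testFunction`); as `K → ∞` these tend (dominated convergence,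
part 1) to the uncut Gaussian values, for which the functional equals `log((4π)⁻² Z_∞)` EXACTLY,
`Z_∞ = ∫_N e^{-φ} · ∫_ℝ e^{-t²/4} = 2√π ∫_N e^{-φ}`, by `R + |∇φ|² = φ`, the sharpness identity
`∫_N φ e^{-φ} = (3/2)∫_N e^{-φ}` (part 3, `…Shrinker`, `integral_potential_mul_exp_neg`) and its 1-d
analogue `∫ (t²/4)e^{-t²/4} = ½∫e^{-t²/4} = √π` (part 2, `…Gaussian`); `exists_index_of_limits`
(part 2) picks `K`. The antecedent `shrinkerPotentialGrowth` supplies `R ≥ 0`, properness and the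
integrable weights (part 3, `shrinkerWeights`); the antecedent `CarrilloNi2009_shrinkerLSI` is not
needed (its clause (iii) is re-derived from properness by the proved layer
`ShrinkerEntropyProofs.lean`).

## References

* [HaslhoferMuller2011] R. Haslhofer, R. Müller, GAFA 21 (2011), §2 (p. 5): (2.6), Lemmas 2.1–2.2,
  and "any polynomial in `R, f, |∇f|` is integrable with respect to `e^{-f}dV`".
* [CarrilloNi2009] J. A. Carrillo, L. Ni, Comm. Anal. Geom. 17 (2009), §4 (sharpness:
  `u = e^{-f}/(4πτ)^{n/2}` is the minimiser; `∫ Δ e^{-f} = 0`).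
-/

noncomputable section

-- `Summit.SmoothPoincare4.SmoothPoincare4.…` (summit = problem) trips `dupNamespace` on every decl.
set_option linter.dupNamespace false

namespace Summit.SmoothPoincare4.SmoothPoincare4.Theorems.NoncompactShrinkerGapModelValueSplitLine

open scoped Manifold ContDiff Topology ENNReal NNReal
open MeasureTheory Filter Set
-- `E3 = EuclideanSpace ℝ (Fin 3)` is `Literature.Geometry.Lorentzian.E3` (`Basic.lean`), an `abbrev`
-- (reducibly) equal to the skeleton's `E3` of the registered signature.
open Literature.Geometry.Lorentzian Literature.Geometry.Riemannian

/-! ### Fubini bookkeeping on `N × ℝ` -/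

/-- `(ab)² log (ab)² = (a² log a²) b² + a² (b² log b²)` (also when `a b = 0`). [folklore] -/
theorem mul_sq_mul_log (a b : ℝ) : (a * b) ^ 2 * Real.log ((a * b) ^ 2) =
    a ^ 2 * Real.log (a ^ 2) * b ^ 2 + a ^ 2 * (b ^ 2 * Real.log (b ^ 2)) := by
  rw [mul_pow]
  by_cases ha : a = 0
  · simp [ha]
  by_cases hb : b = 0
  · simp [hb]
  rw [Real.log_mul (pow_ne_zero 2 ha) (pow_ne_zero 2 hb)]
  ring

/-- **Fubini for the factorised functional**: the integral over `μ ⊗ dt` of the combination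
`f₂g₁ + 4(f₃g₁ + f₁g₂) − ((f₄ − f₅)g₁ + f₁(g₃ − g₄))` of products of integrable factors is the same
combination of the products of the factor integrals (`integral_prod_mul`). [folklore] -/
theorem integral_combination {X : Type*} [MeasurableSpace X] {μ : Measure X} [SFinite μ]
    {f1 f2 f3 f4 f5 : X → ℝ} {g1 g2 g3 g4 : ℝ → ℝ} (hf1 : Integrable f1 μ) (hf2 : Integrable f2 μ)
    (hf3 : Integrable f3 μ) (hf4 : Integrable f4 μ) (hf5 : Integrable f5 μ) (hg1 : Integrable g1)
    (hg2 : Integrable g2) (hg3 : Integrable g3) (hg4 : Integrable g4) :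
    ∫ p, (f2 p.1 * g1 p.2 + 4 * (f3 p.1 * g1 p.2 + f1 p.1 * g2 p.2) -
        ((f4 p.1 - f5 p.1) * g1 p.2 + f1 p.1 * (g3 p.2 - g4 p.2))) ∂(μ.prod volume) =
      (∫ x, f2 x ∂μ) * (∫ t, g1 t) +
          4 * ((∫ x, f3 x ∂μ) * (∫ t, g1 t) + (∫ x, f1 x ∂μ) * (∫ t, g2 t)) -
        (((∫ x, f4 x ∂μ) - ∫ x, f5 x ∂μ) * (∫ t, g1 t) +
          (∫ x, f1 x ∂μ) * ((∫ t, g3 t) - ∫ t, g4 t)) := by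
  have i21 := hf2.mul_prod hg1
  have i31 := hf3.mul_prod hg1
  have i12 := hf1.mul_prod hg2
  have i451 := (hf4.sub hf5).mul_prod hg1
  have i134 := hf1.mul_prod (hg3.sub hg4)
  simp only [Pi.sub_apply] at i451 i134
  rw [integral_sub (i21.fun_add ((i31.fun_add i12).const_mul 4)) (i451.fun_add i134),
    integral_add i21 ((i31.fun_add i12).const_mul 4), integral_const_mul, integral_add i31 i12,
    integral_add i451 i134, integral_prod_mul, integral_prod_mul, integral_prod_mul,
    integral_prod_mul (fun x ↦ f4 x - f5 x) g1, integral_prod_mul f1 (fun t ↦ g3 t - g4 t),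
    integral_sub hf4 hf5, integral_sub hg3 hg4]

/-! ### The test functions `W_K(y,t) = F_K(φ y) F_K(t²/4)` -/

section TestFunction

variable {N : Type} {φ : N → ℝ} {ρ : ℝ → ℝ} {C K : ℝ} {W : N × ℝ → ℝ}

/-- `W_K² = (ρ(φ/K)² e^{-φ}) · (ρ(ψ/K)² e^{-ψ})`, `ψ = t²/4`. [folklore] -/
theorem testFunction_sq (hW : W = fun p ↦ ρ (φ p.1 / K) * Real.exp (-φ p.1 / 2) *
      (ρ (p.2 ^ 2 / 4 / K) * Real.exp (-(p.2 ^ 2 / 4) / 2))) (p : N × ℝ) :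
    W p ^ 2 = ρ (φ p.1 / K) ^ 2 * Real.exp (-φ p.1) *
      (ρ (p.2 ^ 2 / 4 / K) ^ 2 * Real.exp (-(p.2 ^ 2 / 4))) := by
  rw [hW, mul_pow, profileF_sq, profileF_sq]

/-- `W_K² log W_K²` factorised: `(a² log a²) b² + a² (b² log b²)` with
`a² log a² = (ρ² log ρ²)(φ/K) e^{-φ} − ρ(φ/K)² φ e^{-φ}` and likewise in `t`. [folklore] -/
theorem testFunction_sq_mul_log (hW : W = fun p ↦ ρ (φ p.1 / K) * Real.exp (-φ p.1 / 2) *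
      (ρ (p.2 ^ 2 / 4 / K) * Real.exp (-(p.2 ^ 2 / 4) / 2))) (p : N × ℝ) :
    W p ^ 2 * Real.log (W p ^ 2) =
      (ρ (φ p.1 / K) ^ 2 * Real.log (ρ (φ p.1 / K) ^ 2) * Real.exp (-φ p.1) -
          ρ (φ p.1 / K) ^ 2 * (φ p.1 * Real.exp (-φ p.1))) *
        (ρ (p.2 ^ 2 / 4 / K) ^ 2 * Real.exp (-(p.2 ^ 2 / 4))) +
      ρ (φ p.1 / K) ^ 2 * Real.exp (-φ p.1) *
        (ρ (p.2 ^ 2 / 4 / K) ^ 2 * Real.log (ρ (p.2 ^ 2 / 4 / K) ^ 2) * Real.exp (-(p.2 ^ 2 / 4)) -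
          ρ (p.2 ^ 2 / 4 / K) ^ 2 * (p.2 ^ 2 / 4 * Real.exp (-(p.2 ^ 2 / 4)))) := by
  rw [hW, mul_sq_mul_log, profileF_sq_mul_log, profileF_sq_mul_log, profileF_sq, profileF_sq]

variable [TopologicalSpace N] [ChartedSpace E3 N]

/-- **`W_K` is smooth** on the product manifold `N × ℝ`. [folklore] -/
theorem contMDiff_testFunction (hφ : ContMDiff (𝓡 3) 𝓘(ℝ, ℝ) ∞ φ) (hs : ContDiff ℝ ∞ ρ)
    (hW : W = fun p ↦ ρ (φ p.1 / K) * Real.exp (-φ p.1 / 2) *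
      (ρ (p.2 ^ 2 / 4 / K) * Real.exp (-(p.2 ^ 2 / 4) / 2))) :
    ContMDiff ((𝓡 3).prod 𝓘(ℝ, ℝ)) 𝓘(ℝ, ℝ) ∞ W := by
  subst hW
  exact (((contDiff_profileF hs K).comp_contMDiff hφ).comp contMDiff_fst).mul
    ((contDiff_comp_psi (contDiff_profileF hs K)).contMDiff.comp contMDiff_snd)

omit [ChartedSpace E3 N] in
/-- **`W_K` has compact support in `{φ < 3K+1} × (−(3K+1), 3K+1)`** (`K ≥ 1`; the factors vanish
off `{φ ≤ 2K}` and `[-3K, 3K]`). [folklore] -/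
theorem support_testFunction (hφc : Continuous φ) (hprop : ∀ R : ℝ, IsCompact {y : N | φ y ≤ R})
    (h0 : ∀ t, 2 ≤ t → ρ t = 0) (hK : 1 ≤ K)
    (hW : W = fun p ↦ ρ (φ p.1 / K) * Real.exp (-φ p.1 / 2) *
      (ρ (p.2 ^ 2 / 4 / K) * Real.exp (-(p.2 ^ 2 / 4) / 2))) :
    HasCompactSupport W ∧
      tsupport W ⊆ {y : N | φ y < 3 * K + 1} ×ˢ Ioo (-(3 * K + 1)) (3 * K + 1) := by
  have hK0 : 0 < K := by linarith
  have hF0 : ∀ s, 2 * K ≤ s → ρ (s / K) * Real.exp (-s / 2) = 0 := fun s hs ↦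
    profileF_eq_zero h0 hK0 hs
  obtain ⟨ha, hta⟩ := hasCompactSupport_comp hφc hprop hF0
  obtain ⟨-, hb, htb⟩ := lineFactor_support hK hF0
  set S : Set (N × ℝ) := tsupport (fun z ↦ ρ (φ z / K) * Real.exp (-φ z / 2)) ×ˢ
    tsupport (fun t : ℝ ↦ ρ (t ^ 2 / 4 / K) * Real.exp (-(t ^ 2 / 4) / 2)) with hS
  have hSc : IsCompact S := ha.isCompact.prod hb.isCompact
  have hScl : IsClosed S := (isClosed_tsupport _).prod (isClosed_tsupport _)
  have hzero : ∀ p ∉ S, W p = 0 := by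
    intro p hp
    rw [hS, mem_prod, not_and_or] at hp
    simp only [hW]
    rcases hp with hp | hp
    · rw [image_eq_zero_of_notMem_tsupport hp, zero_mul]
    · rw [image_eq_zero_of_notMem_tsupport hp, mul_zero]
  refine ⟨HasCompactSupport.intro' hSc hScl hzero, ?_⟩
  have hsub : tsupport W ⊆ S :=
    closure_minimal (fun p hp ↦ by by_contra h'; exact hp (hzero p h')) hScl
  refine hsub.trans (prod_mono (hta.trans fun y hy ↦ ?_) (htb.trans (Icc_subset_Ioo ?_ ?_)))
  · rw [mem_setOf_eq] at hy ⊢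
    linarith
  · linarith
  · linarith

variable [IsManifold (𝓡 3) ∞ N]
  {h : PseudoRiemannianMetric (𝓡 3) ∞ E3 (TangentSpace (𝓡 3) : N → Type _)} [h.HasLeviCivita]

/-- **The functional's integrand, factorised** (the heart of the bookkeeping): with
`|∇_h W(·,t)|² = F_K(ψ)² F_K'(φ)² |∇φ|²` (chain rule on `N`) and `(∂_t W)² = F_K(φ)² F_K'(ψ)² ψ`
(`ψ'² = ψ`), the integrand `R_h W² + 4(|∇_h W|² + (∂_t W)²) − W² log W²` is the combination
`f₂g₁ + 4(f₃g₁ + f₁g₂) − ((f₄ − f₅)g₁ + f₁(g₃ − g₄))` of the nine factors. [folklore] -/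
theorem integrand_eq (hφ : ContMDiff (𝓡 3) 𝓘(ℝ, ℝ) ∞ φ) (hs : ContDiff ℝ ∞ ρ)
    (hW : W = fun p ↦ ρ (φ p.1 / K) * Real.exp (-φ p.1 / 2) *
      (ρ (p.2 ^ 2 / 4 / K) * Real.exp (-(p.2 ^ 2 / 4) / 2))) (p : N × ℝ) :
    h.scalarCurvature p.1 * W p ^ 2 +
          4 * (h.gradSq (fun y ↦ W (y, p.2)) p.1 + deriv (fun t ↦ W (p.1, t)) p.2 ^ 2) -
        W p ^ 2 * Real.log (W p ^ 2) =
      ρ (φ p.1 / K) ^ 2 * (h.scalarCurvature p.1 * Real.exp (-φ p.1)) *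
            (ρ (p.2 ^ 2 / 4 / K) ^ 2 * Real.exp (-(p.2 ^ 2 / 4))) +
          4 * ((deriv ρ (φ p.1 / K) / K - ρ (φ p.1 / K) / 2) ^ 2 *
                (h.gradSq φ p.1 * Real.exp (-φ p.1)) *
              (ρ (p.2 ^ 2 / 4 / K) ^ 2 * Real.exp (-(p.2 ^ 2 / 4))) +
            ρ (φ p.1 / K) ^ 2 * Real.exp (-φ p.1) *
              ((deriv ρ (p.2 ^ 2 / 4 / K) / K - ρ (p.2 ^ 2 / 4 / K) / 2) ^ 2 *
                (p.2 ^ 2 / 4 * Real.exp (-(p.2 ^ 2 / 4))))) -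
        ((ρ (φ p.1 / K) ^ 2 * Real.log (ρ (φ p.1 / K) ^ 2) * Real.exp (-φ p.1) -
              ρ (φ p.1 / K) ^ 2 * (φ p.1 * Real.exp (-φ p.1))) *
            (ρ (p.2 ^ 2 / 4 / K) ^ 2 * Real.exp (-(p.2 ^ 2 / 4))) +
          ρ (φ p.1 / K) ^ 2 * Real.exp (-φ p.1) *
            (ρ (p.2 ^ 2 / 4 / K) ^ 2 * Real.log (ρ (p.2 ^ 2 / 4 / K) ^ 2) *
                Real.exp (-(p.2 ^ 2 / 4)) -
              ρ (p.2 ^ 2 / 4 / K) ^ 2 * (p.2 ^ 2 / 4 * Real.exp (-(p.2 ^ 2 / 4))))) := by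
  have hgrad : h.gradSq (fun y ↦ W (y, p.2)) p.1 =
      (ρ (p.2 ^ 2 / 4 / K) * Real.exp (-(p.2 ^ 2 / 4) / 2)) ^ 2 *
        (((deriv ρ (φ p.1 / K) / K - ρ (φ p.1 / K) / 2) * Real.exp (-φ p.1 / 2)) ^ 2 *
          h.gradSq φ p.1) := by
    rw [hW]
    exact gradSq_comp_mul_const hφ (F := fun s ↦ ρ (s / K) * Real.exp (-s / 2))
      (contDiff_profileF hs K) (hasDerivAt_profileF hs K (φ p.1))
      (ρ (p.2 ^ 2 / 4 / K) * Real.exp (-(p.2 ^ 2 / 4) / 2))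
  have hder : deriv (fun t ↦ W (p.1, t)) p.2 ^ 2 =
      (ρ (φ p.1 / K) * Real.exp (-φ p.1 / 2)) ^ 2 *
        (((deriv ρ (p.2 ^ 2 / 4 / K) / K - ρ (p.2 ^ 2 / 4 / K) / 2) *
            Real.exp (-(p.2 ^ 2 / 4) / 2)) ^ 2 * (p.2 ^ 2 / 4)) := by
    rw [hW]
    exact deriv_const_mul_comp_psi_sq (F := fun s ↦ ρ (s / K) * Real.exp (-s / 2))
      (hasDerivAt_profileF hs K (p.2 ^ 2 / 4)) (ρ (φ p.1 / K) * Real.exp (-φ p.1 / 2))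
  rw [testFunction_sq_mul_log hW, testFunction_sq hW, hgrad, hder, profileF_sq, profileF_sq,
    profileF_deriv_sq_mul, profileF_deriv_sq_mul]
  ring

variable [T3Space N] [MeasurableSpace N] [BorelSpace N]

omit [h.HasLeviCivita] in
/-- `∫ W_K² = A₁ B₁` (Fubini). [folklore] -/
theorem integral_sq_testFunction [SFinite h.riemVolume]
    (hW : W = fun p ↦ ρ (φ p.1 / K) * Real.exp (-φ p.1 / 2) *
      (ρ (p.2 ^ 2 / 4 / K) * Real.exp (-(p.2 ^ 2 / 4) / 2))) :
    ∫ p, W p ^ 2 ∂(h.riemVolume.prod volume) =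
      (∫ y, ρ (φ y / K) ^ 2 * Real.exp (-φ y) ∂h.riemVolume) *
        ∫ t, ρ (t ^ 2 / 4 / K) ^ 2 * Real.exp (-(t ^ 2 / 4)) := by
  simp_rw [testFunction_sq hW]
  exact integral_prod_mul (μ := h.riemVolume) (ν := volume)
    (fun y ↦ ρ (φ y / K) ^ 2 * Real.exp (-φ y))
    (fun t ↦ ρ (t ^ 2 / 4 / K) ^ 2 * Real.exp (-(t ^ 2 / 4)))

/-- **The functional's numerator of `W_K`, factorised**:
`∫ [R W² + 4(|∇_hW|² + (∂_tW)²) − W² log W²] = A₂B₁ + 4(A₃B₁ + A₁B₂) − ((A₄ − A₅)B₁ + A₁(B₃ − B₄))`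
(pointwise `integrand_eq`, integrability of the nine factors from the weights, Fubini).
[folklore] -/
theorem integral_integrand_testFunction [SFinite h.riemVolume] (hφ : ContMDiff (𝓡 3) 𝓘(ℝ, ℝ) ∞ φ)
    (hs : ContDiff ℝ ∞ ρ) (h01 : ∀ t, 0 ≤ ρ t ∧ ρ t ≤ 1) (hC0 : 0 ≤ C) (hC : ∀ t, |deriv ρ t| ≤ C)
    (hK : 1 ≤ K) (hint : Integrable (fun y ↦ Real.exp (-φ y)) h.riemVolume)
    (hfint : Integrable (fun y ↦ φ y * Real.exp (-φ y)) h.riemVolume)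
    (hRint : Integrable (fun y ↦ h.scalarCurvature y * Real.exp (-φ y)) h.riemVolume)
    (hgint : Integrable (fun y ↦ h.gradSq φ y * Real.exp (-φ y)) h.riemVolume)
    (hW : W = fun p ↦ ρ (φ p.1 / K) * Real.exp (-φ p.1 / 2) *
      (ρ (p.2 ^ 2 / 4 / K) * Real.exp (-(p.2 ^ 2 / 4) / 2))) :
    ∫ p, (h.scalarCurvature p.1 * W p ^ 2 +
          4 * (h.gradSq (fun y ↦ W (y, p.2)) p.1 + deriv (fun t ↦ W (p.1, t)) p.2 ^ 2) -
        W p ^ 2 * Real.log (W p ^ 2)) ∂(h.riemVolume.prod volume) =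
      (∫ y, ρ (φ y / K) ^ 2 * (h.scalarCurvature y * Real.exp (-φ y)) ∂h.riemVolume) *
            (∫ t, ρ (t ^ 2 / 4 / K) ^ 2 * Real.exp (-(t ^ 2 / 4))) +
          4 * ((∫ y, (deriv ρ (φ y / K) / K - ρ (φ y / K) / 2) ^ 2 *
                  (h.gradSq φ y * Real.exp (-φ y)) ∂h.riemVolume) *
                (∫ t, ρ (t ^ 2 / 4 / K) ^ 2 * Real.exp (-(t ^ 2 / 4))) +
              (∫ y, ρ (φ y / K) ^ 2 * Real.exp (-φ y) ∂h.riemVolume) *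
                ∫ t, (deriv ρ (t ^ 2 / 4 / K) / K - ρ (t ^ 2 / 4 / K) / 2) ^ 2 *
                  (t ^ 2 / 4 * Real.exp (-(t ^ 2 / 4)))) -
        (((∫ y, ρ (φ y / K) ^ 2 * Real.log (ρ (φ y / K) ^ 2) * Real.exp (-φ y) ∂h.riemVolume) -
              ∫ y, ρ (φ y / K) ^ 2 * (φ y * Real.exp (-φ y)) ∂h.riemVolume) *
            (∫ t, ρ (t ^ 2 / 4 / K) ^ 2 * Real.exp (-(t ^ 2 / 4))) +
          (∫ y, ρ (φ y / K) ^ 2 * Real.exp (-φ y) ∂h.riemVolume) *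
            ((∫ t, ρ (t ^ 2 / 4 / K) ^ 2 * Real.log (ρ (t ^ 2 / 4 / K) ^ 2) *
                Real.exp (-(t ^ 2 / 4))) -
              ∫ t, ρ (t ^ 2 / 4 / K) ^ 2 * (t ^ 2 / 4 * Real.exp (-(t ^ 2 / 4))))) := by
  have hφm : AEStronglyMeasurable φ h.riemVolume := hφ.continuous.aestronglyMeasurable
  have hψm : AEStronglyMeasurable (fun t : ℝ ↦ t ^ 2 / 4) volume :=
    ((continuous_pow 2).div_const 4).aestronglyMeasurable
  have hf1 : Integrable (fun y ↦ ρ (φ y / K) ^ 2 * Real.exp (-φ y)) h.riemVolume :=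
    integrable_profile_sq_mul hs h01 hφm hint K
  have hf2 : Integrable (fun y ↦ ρ (φ y / K) ^ 2 * (h.scalarCurvature y * Real.exp (-φ y)))
      h.riemVolume := integrable_profile_sq_mul hs h01 hφm hRint K
  have hf3 : Integrable (fun y ↦ (deriv ρ (φ y / K) / K - ρ (φ y / K) / 2) ^ 2 *
      (h.gradSq φ y * Real.exp (-φ y))) h.riemVolume :=
    integrable_profile_deriv_sq_mul hs h01 hC0 hC hφm hgint hK
  have hf4 : Integrable (fun y ↦ ρ (φ y / K) ^ 2 * Real.log (ρ (φ y / K) ^ 2) * Real.exp (-φ y))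
      h.riemVolume := integrable_profile_sq_log_mul hs h01 hφm hint K
  have hf5 : Integrable (fun y ↦ ρ (φ y / K) ^ 2 * (φ y * Real.exp (-φ y))) h.riemVolume :=
    integrable_profile_sq_mul hs h01 hφm hfint K
  have hg1 : Integrable (fun t : ℝ ↦ ρ (t ^ 2 / 4 / K) ^ 2 * Real.exp (-(t ^ 2 / 4))) :=
    integrable_profile_sq_mul hs h01 hψm integrable_exp_neg_psi K
  have hg2 : Integrable (fun t : ℝ ↦ (deriv ρ (t ^ 2 / 4 / K) / K - ρ (t ^ 2 / 4 / K) / 2) ^ 2 *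
      (t ^ 2 / 4 * Real.exp (-(t ^ 2 / 4)))) :=
    integrable_profile_deriv_sq_mul hs h01 hC0 hC hψm integrable_psi_mul_exp_neg_psi hK
  have hg3 : Integrable (fun t : ℝ ↦ ρ (t ^ 2 / 4 / K) ^ 2 * Real.log (ρ (t ^ 2 / 4 / K) ^ 2) *
      Real.exp (-(t ^ 2 / 4))) :=
    integrable_profile_sq_log_mul hs h01 hψm integrable_exp_neg_psi K
  have hg4 :
      Integrable (fun t : ℝ ↦ ρ (t ^ 2 / 4 / K) ^ 2 * (t ^ 2 / 4 * Real.exp (-(t ^ 2 / 4)))) :=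
    integrable_profile_sq_mul hs h01 hψm integrable_psi_mul_exp_neg_psi K
  rw [integral_congr_ae (Eventually.of_forall (integrand_eq (h := h) hφ hs hW))]
  exact integral_combination hf1 hf2 hf3 hf4 hf5 hg1 hg2 hg3 hg4

end TestFunction

/-! ### The stub -/

/-- **Stub `stub_modelValueSplitLine` (U2) of line `collapsed-ends-usc`** — the model value on the
split limit: for a complete connected normalised 3-d gradient shrinker `(N, h, φ)` and `ε > 0`,
the cut-offs `W_K(y,t) = ρ(φ/K)e^{-φ/2} · ρ(t²/4K)e^{-t²/8}` are smooth, compactly supported in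
`{φ < 3K+1} × (−3K−1, 3K+1)`, have `∫ W_K² > 0`, and for `K` large their Perelman functional on
`(N × ℝ, dV_h ⊗ dt)` is `≤ log((4π)⁻² · 2√π ∫_N e^{-φ} dV_h) + ε` (Haslhofer–Müller 2011 §2 for the
weights, Carrillo–Ni 2009 §4 for the exact value; registered signature verbatim).
[cite: HaslhoferMuller2011, §2: (2.6), Lemmas 2.1–2.2] -/
theorem stub_modelValueSplitLine : shrinkerPotentialGrowth → CarrilloNi2009_shrinkerLSI → ∀ (N : Type) [TopologicalSpace N] [T2Space N] [SecondCountableTopology N] [ChartedSpace E3 N] [IsManifold (𝓡 3) ∞ N] [ConnectedSpace N] [T3Space N] [MeasurableSpace N] [BorelSpace N] (h : PseudoRiemannianMetric (𝓡 3) ∞ E3 (TangentSpace (𝓡 3) : N → Type _)) [h.HasLeviCivita] (φ : N → ℝ) (hh : h.IsRiemannian), (∀ (y : N) (r : NNReal), IsCompact {z : N | h.edist hh y z ≤ r}) → ContMDiff (𝓡 3) 𝓘(ℝ, ℝ) ∞ φ → (∀ (y : N) (X Y : TangentSpace (𝓡 3) y), h.ricci y X Y + h.hessian φ y X Y = (1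 / 2 : ℝ) * h.val y X Y) → (∀ y : N, h.scalarCurvature y + h.gradSq φ y = φ y) → ∀ ε : ℝ, 0 < ε → ∃ (R : ℝ) (W : N × ℝ → ℝ), ContMDiff ((𝓡 3).prod 𝓘(ℝ, ℝ)) 𝓘(ℝ, ℝ) ∞ W ∧ HasCompactSupport W ∧ tsupport W ⊆ {y : N | φ y < R} ×ˢ Set.Ioo (-R) R ∧ 0 < ∫ p, W p ^ 2 ∂(h.riemVolume.prod volume) ∧ (∫ p, (h.scalarCurvature p.1 * W p ^ 2 + 4 * (h.gradSq (fun y ↦ W (y, p.2)) p.1 + deriv (fun t ↦ W (p.1, t)) p.2 ^ 2) - W p ^ 2 * Real.log (W p ^ 2)) ∂(h.riemVolume.prod volume)) / (∫ p, W p ^ 2 ∂(h.riemVolume.prod volume)) + Real.log (∫ p, W p ^ 2 ∂(h.riemVolume.prod volume)) - Real.log ((4 * Real.pi) ^ 2) - 4 ≤ Real.log ((4 * Real.pi) ^ (-(4 : ℝ) / 2) * (2 * Real.sqrt Real.pi * ∫ y, Real.exp (-φ y) ∂h.riemVolume)) + ε := by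
  intro hgrowth _hCN N _ _ _ _ _ _ _ _ _ h _ φ hh hc hφ hsol hnorm ε hε
  -- the profile, the weights, Fubini
  obtain ⟨ρ, hs, h1, h0, h01, hd, C, hC0, hC⟩ := exists_profile
  obtain ⟨hR0, -, -, -, -, hprop, hint, hfint, hRint, hgint⟩ :=
    shrinkerWeights hgrowth hh hc hφ hsol hnorm
  haveI := sigmaFinite_riemVolume hh hprop
  have hφm : AEStronglyMeasurable φ h.riemVolume := hφ.continuous.aestronglyMeasurable
  have hψm : AEStronglyMeasurable (fun t : ℝ ↦ t ^ 2 / 4) volume :=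
    ((continuous_pow 2).div_const 4).aestronglyMeasurable
  -- the uncut values
  have hA : 0 < ∫ y, Real.exp (-φ y) ∂h.riemVolume := integral_exp_neg_pos hh hint
  have hB : 0 < 2 * Real.sqrt Real.pi := by positivity
  have hAφ : ∫ y, φ y * Real.exp (-φ y) ∂h.riemVolume =
      3 / 2 * ∫ y, Real.exp (-φ y) ∂h.riemVolume := by
    rw [integral_potential_mul_exp_neg hh hφ hsol hnorm hprop hR0]
    norm_num
  have hRG : (∫ y, h.scalarCurvature y * Real.exp (-φ y) ∂h.riemVolume) +
      ∫ y, h.gradSq φ y * Real.exp (-φ y) ∂h.riemVolume =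
      ∫ y, φ y * Real.exp (-φ y) ∂h.riemVolume := by
    rw [← integral_add hRint hgint]
    refine integral_congr_ae (Eventually.of_forall fun y ↦ ?_)
    show h.scalarCurvature y * Real.exp (-φ y) + h.gradSq φ y * Real.exp (-φ y) =
      φ y * Real.exp (-φ y)
    rw [← add_mul, hnorm y]
  have hBψ : Real.sqrt Real.pi = 2 * Real.sqrt Real.pi / 2 := by ring
  -- the nine limits along the cut-offs `K = k + 1`
  have L1 := tendsto_integral_profile_sq_mul hs h1 h01 hφm hint
  have L2 := tendsto_integral_profile_sq_mul hs h1 h01 hφm hRint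
  have L3 := tendsto_integral_profile_deriv_sq_mul hs h1 h01 hd hC0 hC hφm hgint
  have L4 := tendsto_integral_profile_sq_log_mul hs h1 h01 hφm hint
  have L5 := tendsto_integral_profile_sq_mul hs h1 h01 hφm hfint
  have L6 := tendsto_integral_profile_sq_mul hs h1 h01 hψm integrable_exp_neg_psi
  have L7 := tendsto_integral_profile_deriv_sq_mul hs h1 h01 hd hC0 hC hψm
    integrable_psi_mul_exp_neg_psi
  have L8 := tendsto_integral_profile_sq_log_mul hs h1 h01 hψm integrable_exp_neg_psi
  have L9 := tendsto_integral_profile_sq_mul hs h1 h01 hψm integrable_psi_mul_exp_neg_psi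
  rw [integral_exp_neg_psi] at L6
  rw [integral_psi_mul_exp_neg_psi] at L7 L9
  obtain ⟨k, hZk, hFk⟩ :=
    exists_index_of_limits hA hB hRG hAφ hBψ L1 L2 L3 L4 L5 L6 L7 L8 L9 hε
  -- the `ε`-good test function
  have hK : (1 : ℝ) ≤ (k : ℝ) + 1 := by simp
  obtain ⟨W, hW⟩ : ∃ W : N × ℝ → ℝ, W = fun p ↦ ρ (φ p.1 / ((k : ℝ) + 1)) *
      Real.exp (-φ p.1 / 2) * (ρ (p.2 ^ 2 / 4 / ((k : ℝ) + 1)) * Real.exp (-(p.2 ^ 2 / 4) / 2)) :=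
    ⟨_, rfl⟩
  obtain ⟨hWc, hWt⟩ := support_testFunction hφ.continuous hprop h0 hK hW
  refine ⟨3 * ((k : ℝ) + 1) + 1, W, contMDiff_testFunction hφ hs hW, hWc, hWt, ?_, ?_⟩
  · rw [integral_sq_testFunction hW]
    exact hZk
  · rw [integral_integrand_testFunction hφ hs h01 hC0 hC hK hint hfint hRint hgint hW,
      integral_sq_testFunction hW]
    exact hFk

end Summit.SmoothPoincare4.SmoothPoincare4.Theorems.NoncompactShrinkerGapModelValueSplitLine

end
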